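/-
Copyright (c) 2026 the pub-hodgecm-mathlib formalisation cell (harness21).  Prover seat hodgecm-mathlib-K2Liu-p13 (g5), Track B «K2-LIT»,
#184♮ = hLiu418 = `stmt-HodgeConjecture-24832`; socket #41, KIND W, (iii-fin) row, brick (ι′) — KW desk F0P2-p08 (g4) 2026-09-05T01:29:03Z (2): the SIBLING of ★ p864124
`K2LiuKindWFiniteLevelLetters` carrying the two extra readings the (R) payers (K2E3-p06 (g7) ∕ K2E3-p29 (g3) `hstab_of_letters`) bind BY VALUE: `hMlev` and `hMK`.
THEOREMS ONLY (no `def`, no `instance`, no notation, no named-fact hypothesis, no `sorry`); lane `--supports stmt-HodgeConjecture-24832 --as helper` (count-neutral helper).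
-/
import Summits.HodgeConjecture.HodgeConjecture.Theorems.K2LiuKindWFiniteLevelLetters   -- ★ p864124 (this seat): `exists_levelLetters`, `apply_mem_congruenceGL_of_mem_kindWLocalBall`, `sum_placesOver_le`, `one_le_ramificationIdx'`; brings ★ (lat-c), ★ (c1), ★ (c5), ★ `K2LiuKindOneLineLatticeLocalPrelims`, ★ `kindWLocalBall`
import HarnessLib

/-!
# Crux `HLiu418`, socket #41, KIND W — `K2LiuKindWFiniteLevelAdapters` ((ι′)): THE (ι) LEVEL LETTERS WITH THE LEVEL-DOMINATION READING `cL w + 2·A h w ≤ lev h w`,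
# AND THE DICTIONARY «all `H_w(h) ≤ 1` over `v` ⇒ `h_v ∈ K_{H,v}`» GIVING THE (R) PAYER'S `hMK`

Cell `hodgecm-mathlib`, crux item hLiu418 = `stmt-HodgeConjecture-24832` (helper lane `--supports … --as helper`, count-neutral), route of record `HCCMUnconditional`;
squad K2 ∕ K2Liu, road `K2_Liu`, socket #41 `sig_K2LiuSiegelEisensteinContinuation`, KIND W, (iii-fin) row; KW desk F0P2-p08 (g4).  CONSUMERS: K2E3-typ2's tie (one `obtain` on
`exists_levelLetters'` replaces the one on ★ `exists_levelLetters`, one extra name `hAlev`) and the (R) radius-stability payer `hstab_of_letters` (K2E3-p29 (g3) ∕ K2E3-p06 (g7)),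
whose by-value letters at the level `M h w := cL w + 2·A h w` of the translated local factor (★ p863964 §4 `FvT_mul_mul_evalPlace_eq`) are
`hMlev : ∀ h v (w ∣ v), M h w ≤ lev h w` and `hMK : ∀ h v, h_v ∉ K_{H,v} → ∃ w ∣ v, 1 ≤ M h w`.
* §1 **`mem_localInt_of_localHeight_le_one`** — if `H_w(h) ≤ 1` at every `w ∣ v` then `h_v = evalPlace v (finPart h) ∈ U(J^𝔻)(𝒪_v)` (★ `mem_localInt_iff`, ★ `mem_glInt_iff`, the
  entry bounds ★ (c5) `nnnorm_evalPlace_finPart_apply_le`, ★ (c1) `nnnorm_le_pow_iff_v_le`, ★ `v_le_one_iff_mem_integer`); **`hMK_of_hA`** — with (ι)'s `hA : H_w(h) ≤ q_w^{A h w}`: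
  `h_v ∉ K_{H,v} ⇒ ∃ w ∣ v, 1 ≤ cL w + 2·A h w` (else every `A h w = 0`, so every `H_w(h) ≤ 1`).
* §2 **`exists_levelLetters'`** — ★ `exists_levelLetters` (binders and five conclusions BYTE FOR BYTE, same witnesses `a₀ h v := Σ_{w′∣v}(cL + d₂ + 2A)`, `lev h w := e(w|v)·a₀`,
  `δ₀`, `k := 8`) with a SIXTH conclusion `∀ h v (w ∣ v), cL w + 2·A h w ≤ lev h w` (one summand of the sum, `e(w|v) ≥ 1`) — not derivable from the ★ head after the `∃`, hence
  re-proved here with the extra line.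
[BorelJacquet1979, §1.2, §4.1]; [PlatonovRapinchuk1994, §5.1]; [MoeglinWaldspurger1995, I.2.2]; [Casselman1980, §3]; [KudlaRallis1994, §2].

HONEST LABEL.  Count-neutral helper; it retires nothing by itself: `HC_CM` is proved only modulo the 7 printed citations (2 remaining named inputs:
hLiu418 = `stmt-HodgeConjecture-24832`, h413 = `stmt-HodgeConjecture-24833`) until rung 0 closes.

## References
* [BorelJacquet1979] A. Borel, H. Jacquet, *Automorphic forms and automorphic representations*, Proc. Sympos. Pure Math. 33.1 (1979): §1.2 (heights; `H_v(g) = 1 ⟺ g_v ∈ K_v`), §4.1.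
* [PlatonovRapinchuk1994] V. Platonov, A. Rapinchuk, *Algebraic Groups and Number Theory* (1994): §5.1 (integral adelic points, principal congruence subgroups).
* [MoeglinWaldspurger1995] C. Mœglin, J.-L. Waldspurger, *Spectral decomposition and Eisenstein series* (1995): I.2.2.
* [Casselman1980] W. Casselman, Compositio Math. 40 (1980): §3.  [KudlaRallis1994] S. Kudla, S. Rallis, Ann. of Math. 140 (1994): §2.
-/

set_option autoImplicit false
-- the mandated namespace repeats the single-problem summit's segment (`HodgeConjecture.HodgeConjecture`)
set_option linter.dupNamespace false

noncomputable section

open scoped NNReal MatrixGroups WithZero BigOperators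
open NumberField IsDedekindDomain Matrix ValuativeRel Filter
open Literature.NumberTheory.Automorphic Literature.NumberTheory.Automorphic.UnitaryGroup Literature.NumberTheory.GaloisRepresentations
open Literature.NumberTheory.GelbartRogawski1991 Literature.NumberTheory.GelbartRogawski1991.GRConstruction
open Literature.NumberTheory.GelbartRogawski1991.AdaptedBlocks
open Literature.NumberTheory.GelbartRogawski1991.UnitaryDualPair Literature.NumberTheory.GelbartRogawski1991.UnitaryDualPair.LocalSplitting
open Literature.NumberTheory.K2Lit.SiegelDoubled Literature.NumberTheory.K2Lit.LocalSiegelDoubled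
open Summit.HodgeConjecture.HodgeConjecture.Cruxes.HLiu418.K2LiuSiegelUnipotentLocalDefs
open Summit.HodgeConjecture.HodgeConjecture.Cruxes.HLiu418.K2LiuSiegelUnipotentSplitAtDefs
open Summit.HodgeConjecture.HodgeConjecture.Cruxes.HLiu418.K2LiuSiegelUnipotentFourierDefs
open Summit.HodgeConjecture.HodgeConjecture.Cruxes.HLiu418.K2LiuKindWFiniteLetterDefs (kindWLocalBall mem_kindWLocalBall_iff)
open Summit.HodgeConjecture.HodgeConjecture.Cruxes.HLiu418.K2LiuLocalHeightLevelConjugation (exists_localHeight_eq_pow one_lt_absNorm_nnreal nnnorm_le_pow_iff_v_le)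
open Summit.HodgeConjecture.HodgeConjecture.Cruxes.HLiu418.K2LiuKindOneLineLevelConjugation (nnnorm_evalPlace_finPart_apply_le)
open Summit.HodgeConjecture.HodgeConjecture.Cruxes.HLiu418.K2LiuKindOneLineLatticeLetters
  (exists_coe_eq_adelicForm_hermD exists_cofinite_localHeight_le_pow localHeight_le_pow_of_placesOver)
open Summit.HodgeConjecture.HodgeConjecture.Cruxes.HLiu418.K2LiuKindOneLineLatticeLocalPrelims (exists_defect ramificationIdx_le_two)
open Summit.HodgeConjecture.HodgeConjecture.Cruxes.HLiu418.K2LiuKindWFiniteLevelLetters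
  (one_le_ramificationIdx' sum_placesOver_le apply_mem_congruenceGL_of_mem_kindWLocalBall)

namespace Summit.HodgeConjecture.HodgeConjecture.Cruxes.HLiu418.K2LiuKindWFiniteLevelAdapters

variable (L : Type) [Field L] [NumberField L] [IsCMField L]
variable {N M n : ℕ} (e : Fin N × Fin M ≃ Fin n)
  (dV : Fin N → L) (hdV : ∀ i, IsCMField.complexConj L (dV i) = dV i)
  (dW : Fin M → L) (hdW : ∀ i, IsCMField.complexConj L (dW i) = dW i)

/-! ## §1 «all `H_w(h) ≤ 1` over `v` ⇒ `h_v ∈ K_{H,v}`», and the (R) payer's `hMK` -/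

/-- **IF `H_w(h) ≤ 1` AT EVERY PLACE `w ∣ v` THEN `h_v ∈ U(J^𝔻)(𝒪_v)`**: the entries of `(h_v)_w` and of `(h_v)_w⁻¹` are bounded in norm by `H_w(h)` (★ (c5)
`nnnorm_evalPlace_finPart_apply_le`), so they are `w`-integral (★ (c1) `nnnorm_le_pow_iff_v_le` at exponent `0`, ★ `v_le_one_iff_mem_integer`), i.e. `(h_v)_w ∈ GL(𝒪_w)` (★
`mem_glInt_iff`) for every `w ∣ v` (★ `mem_localInt_iff`). [cite: BorelJacquet1979, §1.2] [cite: PlatonovRapinchuk1994, §5.1] -/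
theorem mem_localInt_of_localHeight_le_one (h : HA L e dV hdV dW hdW) (v : HeightOneSpectrum (𝓞 (Fp L)))
    (hH : ∀ w : UnitaryGroup.PlacesOver L v, GLn.localHeight (n + n) L w.1 (h : GL (Fin (n + n)) (AdeleRing (𝓞 L) L)) ≤ 1) :
    UnitaryGroup.evalPlace (Fp L) L (IsCMField.complexConj L) (n + n) (hermD L e dV hdV dW hdW) v
        (UnitaryGroup.finPart (Fp L) L (IsCMField.complexConj L) (n + n) (hermD L e dV hdV dW hdW) h) ∈
      UnitaryGroup.localInt L (IsCMField.complexConj L) (n + n) (hermD L e dV hdV dW hdW) v := by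
  rw [UnitaryGroup.mem_localInt_iff]
  intro w
  -- `‖x‖₊ ≤ 1 ⇒ x ∈ 𝒪_w`
  have key : ∀ x : w.1.adicCompletion L, ‖x‖₊ ≤ 1 → x ∈ 𝒪[w.1.adicCompletion L] := fun x hx => by
    refine (v_le_one_iff_mem_integer x).1 ?_
    have h0 := (nnnorm_le_pow_iff_v_le L w.1 x 0).1 (by rwa [pow_zero])
    rwa [Nat.cast_zero, WithZero.exp_zero] at h0
  rw [mem_glInt_iff]
  exact ⟨fun i j => key _ ((nnnorm_evalPlace_finPart_apply_le (Fp L) L (IsCMField.complexConj L) (n + n) (hermD L e dV hdV dW hdW) v h w i j).1.trans (hH w)),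
    fun i j => key _ ((nnnorm_evalPlace_finPart_apply_le (Fp L) L (IsCMField.complexConj L) (n + n) (hermD L e dV hdV dW hdW) v h w i j).2.trans (hH w))⟩

/-- **THE (R) PAYER'S `hMK` FROM (ι)'s `hA`**: with `H_w(h) ≤ q_w^{A h w}` for all `h, w`, if `h_v ∉ U(J^𝔻)(𝒪_v)` then `1 ≤ cL w + 2·A h w` for some `w ∣ v` — otherwise every
`A h w = 0` over `v`, every `H_w(h) ≤ 1`, and §1 puts `h_v` in `U(J^𝔻)(𝒪_v)`. [cite: BorelJacquet1979, §1.2] [cite: PlatonovRapinchuk1994, §5.1] -/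
theorem hMK_of_hA (cL : HeightOneSpectrum (𝓞 L) → ℕ) (A : HA L e dV hdV dW hdW → HeightOneSpectrum (𝓞 L) → ℕ)
    (hA : ∀ (h : HA L e dV hdV dW hdW) (w : HeightOneSpectrum (𝓞 L)),
      GLn.localHeight (n + n) L w (h : GL (Fin (n + n)) (AdeleRing (𝓞 L) L)) ≤ ((Ideal.absNorm w.asIdeal : ℕ) : ℝ≥0) ^ A h w) :
    ∀ (h : HA L e dV hdV dW hdW) (v : HeightOneSpectrum (𝓞 (Fp L))),
      UnitaryGroup.evalPlace (Fp L) L (IsCMField.complexConj L) (n + n) (hermD L e dV hdV dW hdW) v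
          (UnitaryGroup.finPart (Fp L) L (IsCMField.complexConj L) (n + n) (hermD L e dV hdV dW hdW) h) ∉
        UnitaryGroup.localInt L (IsCMField.complexConj L) (n + n) (hermD L e dV hdV dW hdW) v →
      ∃ w : UnitaryGroup.PlacesOver L v, 1 ≤ cL w.1 + 2 * A h w.1 := by
  intro h v hv
  by_contra hcon
  push Not at hcon
  refine hv (mem_localInt_of_localHeight_le_one L e dV hdV dW hdW h v fun w => ?_)
  have hA0 : A h w.1 = 0 := by have := hcon w; omega
  have hle := hA h w.1
  rwa [hA0, pow_zero] at hle

/-! ## §2 The (ι) level letters with the sixth reading `cL w + 2·A h w ≤ lev h w` -/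

/-- **THE (iii-fin) LEVEL LETTERS OF ★ p863724'S BLOCK, WITH `A a₀` AND THE SIXTH READING** — ★ `K2LiuKindWFiniteLevelLetters.exists_levelLetters` (binders and five
conclusions (A) (δ) (hlev) (dom) (ball) BYTE FOR BYTE, same witnesses `a₀ h v := Σ_{w′∣v} (cL w′ + d₂ w′ + 2·A h w′)`, `lev h w := e(w|v)·a₀ h (w ∩ L⁺)`,
`δ₀ w := 2·((cL w + d₂ w) + (cL (c⁻¹•w) + d₂ (c⁻¹•w))) + 8·j w`, `k := 8`, `A` exact by ★ (c1), `A = k = 0` at `n = 0`) PLUS (Alev) `∀ h v (w ∣ v), cL w + 2·A h w ≤ lev h w`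
(one summand of the sum, `e(w|v) ≥ 1` ★ `one_le_ramificationIdx'`) = the (R) payer's `hMlev` at `M := cL + 2A`.  See ★ p864124's docstring for the mathematics (split-place seam ★
`localHeight_le_pow_of_placesOver`, `e ≤ 2` ★ `ramificationIdx_le_two`, dyadic defect ★ `exists_defect`, ball ⇒ level ★ `apply_mem_congruenceGL_of_mem_kindWLocalBall`).
[cite: BorelJacquet1979, §1.2, §4.1] [cite: PlatonovRapinchuk1994, §5.1] [cite: MoeglinWaldspurger1995, I.2.2] [cite: KudlaRallis1994, §2] [cite: Casselman1980, §3] -/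
theorem exists_levelLetters' (hdV0 : ∀ i, dV i ≠ 0) (hdW0 : ∀ i, dW i ≠ 0)
    (π : ∀ v : HeightOneSpectrum (𝓞 (Fp L)), v.adicCompletion (Fp L)) (hπ : ∀ v, Valued.v (π v) = WithZero.exp (-1 : ℤ))
    (ϖ : ∀ w : HeightOneSpectrum (𝓞 L), w.adicCompletion L) (hϖ : ∀ w, Valued.v (ϖ w) = WithZero.exp (-1 : ℤ))
    (Tc : Finset (HeightOneSpectrum (𝓞 L))) (cL : HeightOneSpectrum (𝓞 L) → ℕ) (hcL : ∀ w ∉ Tc, cL w = 0) :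
    ∃ (A : HA L e dV hdV dW hdW → HeightOneSpectrum (𝓞 L) → ℕ) (a₀ : HA L e dV hdV dW hdW → HeightOneSpectrum (𝓞 (Fp L)) → ℤ)
      (lev : HA L e dV hdV dW hdW → HeightOneSpectrum (𝓞 L) → ℕ) (Tδ₀ : Finset (HeightOneSpectrum (𝓞 L))) (δ₀ : HeightOneSpectrum (𝓞 L) → ℕ) (k : ℕ),
      (∀ (h : HA L e dV hdV dW hdW) (w : HeightOneSpectrum (𝓞 L)),
        GLn.localHeight (n + n) L w (h : GL (Fin (n + n)) (AdeleRing (𝓞 L) L)) ≤ ((Ideal.absNorm w.asIdeal : ℕ) : ℝ≥0) ^ A h w) ∧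
      (∀ w ∉ Tδ₀, δ₀ w = 0) ∧
      (∀ (h : HA L e dV hdV dW hdW) (w : HeightOneSpectrum (𝓞 L)),
          ((Ideal.absNorm w.asIdeal : ℕ) : ℝ) ^ lev h w ≤ ((Ideal.absNorm w.asIdeal : ℕ) : ℝ) ^ δ₀ w * (GLn.localHeight (n + n) L w (h : GL (Fin (n + n)) (AdeleRing (𝓞 L) L)) : ℝ) ^ k) ∧
      (∀ (h : HA L e dV hdV dW hdW) (v : HeightOneSpectrum (𝓞 (Fp L))) (w : UnitaryGroup.PlacesOver L v),
        (v.asIdeal.ramificationIdx' w.1.asIdeal : ℤ) * a₀ h v ≤ ((lev h w.1 : ℕ) : ℤ)) ∧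
      (∀ (h : HA L e dV hdV dW hdW) (v : HeightOneSpectrum (𝓞 (Fp L))) (u₀ : ↥(unipDeltaLoc L e dV hdV dW hdW v)),
        u₀ ∈ kindWLocalBall L e dV hdV dW hdW v (π v) (a₀ h v) →
        ∀ w : UnitaryGroup.PlacesOver L v,
          ((u₀ : UnitaryGroup.localPi L (IsCMField.complexConj L) (n + n) (hermD L e dV hdV dW hdW) v) : UnitaryGroup.LocalGLPi L (n + n) v) w ∈
            congruenceGL (n + n) (valuation (w.1.adicCompletion L) (ϖ w.1) ^ (cL w.1 + 2 * A h w.1))) ∧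
      (∀ (h : HA L e dV hdV dW hdW) (v : HeightOneSpectrum (𝓞 (Fp L))) (w : UnitaryGroup.PlacesOver L v), cL w.1 + 2 * A h w.1 ≤ lev h w.1) := by
  classical
  -- the dyadic defect `exp(−d₂ w) ≤ |2|_w`, `d₂` cofinitely `0` (★ `exists_defect`)
  obtain ⟨d₂, hd₂, h2⟩ := exists_defect L (x := (2 : L)) two_ne_zero
  -- the height exponents `A`, the exponent `k`, the form's heights `j` (cofinitely `0`), and the A-part of `hlev` — by cases on the rank
  obtain ⟨A, k, j, hjev, hA, hAk⟩ : ∃ (A : HA L e dV hdV dW hdW → HeightOneSpectrum (𝓞 L) → ℕ) (k : ℕ) (j : HeightOneSpectrum (𝓞 L) → ℕ),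
      (∀ᶠ w in cofinite, j w = 0) ∧
      (∀ (h : HA L e dV hdV dW hdW) (w : HeightOneSpectrum (𝓞 L)),
        GLn.localHeight (n + n) L w (h : GL (Fin (n + n)) (AdeleRing (𝓞 L) L)) ≤ ((Ideal.absNorm w.asIdeal : ℕ) : ℝ≥0) ^ A h w) ∧
      (∀ (h : HA L e dV hdV dW hdW) (w : HeightOneSpectrum (𝓞 L)),
        ((Ideal.absNorm w.asIdeal : ℕ) : ℝ) ^ (4 * ∑ w' : UnitaryGroup.PlacesOver L (w.under (𝓞 (Fp L))), A h w'.1) ≤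
          ((Ideal.absNorm w.asIdeal : ℕ) : ℝ) ^ (8 * j w) * (GLn.localHeight (n + n) L w (h : GL (Fin (n + n)) (AdeleRing (𝓞 L) L)) : ℝ) ^ k) := by
    rcases Nat.eq_zero_or_pos n with hn0 | hpos
    · -- degenerate rank `n = 0`: empty matrices, `A = k = j = 0`
      subst hn0
      refine ⟨fun _ _ => 0, 0, fun _ => 0, Filter.Eventually.of_forall fun _ => rfl, fun h w => ?_, fun h w => ?_⟩
      · rw [pow_zero]
        unfold GLn.localHeight
        exact Finset.sup_le fun ij _ => ij.1.elim0
      · simp only [Finset.sum_const_zero, mul_zero, pow_zero, mul_one, le_refl]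
    · haveI : NeZero (n + n) := ⟨by omega⟩
      choose A hA using fun (h : HA L e dV hdV dW hdW) (w : HeightOneSpectrum (𝓞 L)) =>
        exists_localHeight_eq_pow L w (h : GL (Fin (n + n)) (AdeleRing (𝓞 L) L))
      obtain ⟨Jm, hJm⟩ := exists_coe_eq_adelicForm_hermD L e dV hdV dW hdW hdV0 hdW0
      obtain ⟨j, hjev, hJw⟩ := exists_cofinite_localHeight_le_pow L Jm
      refine ⟨A, 8, j, hjev, fun h w => (hA h w).le, fun h w => ?_⟩
      -- both places above `v = w ∩ L⁺` are controlled by `H_w(h) = q_w^{A h w}`: `A h w′ ≤ j w + A h w + j w`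
      have hw' : ∀ w' : UnitaryGroup.PlacesOver L (w.under (𝓞 (Fp L))), A h w'.1 ≤ j w + A h w + j w := fun w' => by
        have hle := localHeight_le_pow_of_placesOver L e dV hdV dW hdW Jm hJm j hJw h w (hA h w) w'
        rw [hA h w'.1] at hle
        exact (pow_le_pow_iff_right₀ (one_lt_absNorm_nnreal L w'.1)).1 hle
      have hSA : ∑ w' : UnitaryGroup.PlacesOver L (w.under (𝓞 (Fp L))), A h w'.1 ≤ 2 * A h w + 2 * j w := by
        refine (sum_placesOver_le L (A h) w).trans ?_
        have h2 := hw' (PlacesOver.galInv (IsCMField.complexConj L) ⟨w, rfl⟩)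
        change A h ((IsCMField.complexConj L)⁻¹ • w) ≤ j w + A h w + j w at h2
        omega
      have hq1 : (1 : ℝ) ≤ ((Ideal.absNorm w.asIdeal : ℕ) : ℝ) := by exact_mod_cast (one_lt_absNorm_nnreal L w).le
      have hH : (GLn.localHeight (n + n) L w (h : GL (Fin (n + n)) (AdeleRing (𝓞 L) L)) : ℝ) = ((Ideal.absNorm w.asIdeal : ℕ) : ℝ) ^ A h w := by
        rw [hA h w, NNReal.coe_pow, NNReal.coe_natCast]
      calc ((Ideal.absNorm w.asIdeal : ℕ) : ℝ) ^ (4 * ∑ w' : UnitaryGroup.PlacesOver L (w.under (𝓞 (Fp L))), A h w'.1)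
          ≤ ((Ideal.absNorm w.asIdeal : ℕ) : ℝ) ^ (8 * j w + A h w * 8) := pow_le_pow_right₀ hq1 (by omega)
        _ = ((Ideal.absNorm w.asIdeal : ℕ) : ℝ) ^ (8 * j w) * (GLn.localHeight (n + n) L w (h : GL (Fin (n + n)) (AdeleRing (𝓞 L) L)) : ℝ) ^ 8 := by
            rw [hH, ← pow_mul, ← pow_add]
  -- the witnesses
  refine ⟨A, fun h v => ((∑ w' : UnitaryGroup.PlacesOver L v, (cL w'.1 + d₂ w'.1 + 2 * A h w'.1) : ℕ) : ℤ),
    fun h w => (w.under (𝓞 (Fp L))).asIdeal.ramificationIdx' w.asIdeal * ∑ w' : UnitaryGroup.PlacesOver L (w.under (𝓞 (Fp L))), (cL w'.1 + d₂ w'.1 + 2 * A h w'.1),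
    ?_, fun w => 2 * ((cL w + d₂ w) + (cL ((IsCMField.complexConj L)⁻¹ • w) + d₂ ((IsCMField.complexConj L)⁻¹ • w))) + 8 * j w, k, hA, ?_, fun h w => ?_,
    fun h v w => ?_, fun h v u₀ hu₀ w => ?_, fun h v w => ?_⟩
  · -- `Tδ₀` := the finite set where `δ₀ ≠ 0`
    exact (Filter.eventually_cofinite.1 (show ∀ᶠ w : HeightOneSpectrum (𝓞 L) in cofinite,
      2 * ((cL w + d₂ w) + (cL ((IsCMField.complexConj L)⁻¹ • w) + d₂ ((IsCMField.complexConj L)⁻¹ • w))) + 8 * j w = 0 from by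
        have h1 : ∀ᶠ w : HeightOneSpectrum (𝓞 L) in cofinite, cL w = 0 := Tc.eventually_cofinite_notMem.mono hcL
        have h1' : ∀ᶠ w : HeightOneSpectrum (𝓞 L) in cofinite, cL ((IsCMField.complexConj L)⁻¹ • w) = 0 :=
          (MulAction.injective (β := HeightOneSpectrum (𝓞 L)) (IsCMField.complexConj L)⁻¹).tendsto_cofinite.eventually h1
        have h3 : ∀ᶠ w : HeightOneSpectrum (𝓞 L) in cofinite, d₂ w = 0 := hd₂
        have h3' : ∀ᶠ w : HeightOneSpectrum (𝓞 L) in cofinite, d₂ ((IsCMField.complexConj L)⁻¹ • w) = 0 :=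
          (MulAction.injective (β := HeightOneSpectrum (𝓞 L)) (IsCMField.complexConj L)⁻¹).tendsto_cofinite.eventually h3
        filter_upwards [h1, h1', h3, h3', hjev] with w e1 e2 e3 e4 e5
        simp only [e1, e2, e3, e4, e5, add_zero, mul_zero])).toFinset
  · -- (δ) `δ₀ = 0` off `Tδ₀`
    intro w hw
    by_contra hne
    exact hw ((Set.Finite.mem_toFinset _).2 hne)
  · -- (hlev) `q_w ^ lev h w ≤ q_w ^ δ₀ w · H_w(h) ^ k`
    have hq1 : (1 : ℝ) ≤ ((Ideal.absNorm w.asIdeal : ℕ) : ℝ) := by exact_mod_cast (one_lt_absNorm_nnreal L w).le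
    have he2 := ramificationIdx_le_two L (w.under (𝓞 (Fp L))) ⟨w, rfl⟩
    have hS₁ := sum_placesOver_le L (fun w'' => cL w'' + d₂ w'') w
    have hsplit : ∑ w' : UnitaryGroup.PlacesOver L (w.under (𝓞 (Fp L))), (cL w'.1 + d₂ w'.1 + 2 * A h w'.1) =
        (∑ w' : UnitaryGroup.PlacesOver L (w.under (𝓞 (Fp L))), (cL w'.1 + d₂ w'.1)) +
          2 * ∑ w' : UnitaryGroup.PlacesOver L (w.under (𝓞 (Fp L))), A h w'.1 := by
      rw [Finset.sum_add_distrib, Finset.mul_sum]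
    have hle : (w.under (𝓞 (Fp L))).asIdeal.ramificationIdx' w.asIdeal *
        ∑ w' : UnitaryGroup.PlacesOver L (w.under (𝓞 (Fp L))), (cL w'.1 + d₂ w'.1 + 2 * A h w'.1) ≤
        2 * ((cL w + d₂ w) + (cL ((IsCMField.complexConj L)⁻¹ • w) + d₂ ((IsCMField.complexConj L)⁻¹ • w))) +
          4 * ∑ w' : UnitaryGroup.PlacesOver L (w.under (𝓞 (Fp L))), A h w'.1 := by
      rw [hsplit]
      refine (Nat.mul_le_mul_right _ he2).trans ?_
      change (∑ w' : UnitaryGroup.PlacesOver L (w.under (𝓞 (Fp L))), (cL w'.1 + d₂ w'.1)) ≤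
        (cL w + d₂ w) + (cL ((IsCMField.complexConj L)⁻¹ • w) + d₂ ((IsCMField.complexConj L)⁻¹ • w)) at hS₁
      omega
    calc ((Ideal.absNorm w.asIdeal : ℕ) : ℝ) ^ ((w.under (𝓞 (Fp L))).asIdeal.ramificationIdx' w.asIdeal *
          ∑ w' : UnitaryGroup.PlacesOver L (w.under (𝓞 (Fp L))), (cL w'.1 + d₂ w'.1 + 2 * A h w'.1))
        ≤ ((Ideal.absNorm w.asIdeal : ℕ) : ℝ) ^ (2 * ((cL w + d₂ w) + (cL ((IsCMField.complexConj L)⁻¹ • w) + d₂ ((IsCMField.complexConj L)⁻¹ • w))) +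
            4 * ∑ w' : UnitaryGroup.PlacesOver L (w.under (𝓞 (Fp L))), A h w'.1) := pow_le_pow_right₀ hq1 hle
      _ = ((Ideal.absNorm w.asIdeal : ℕ) : ℝ) ^ (2 * ((cL w + d₂ w) + (cL ((IsCMField.complexConj L)⁻¹ • w) + d₂ ((IsCMField.complexConj L)⁻¹ • w)))) *
            ((Ideal.absNorm w.asIdeal : ℕ) : ℝ) ^ (4 * ∑ w' : UnitaryGroup.PlacesOver L (w.under (𝓞 (Fp L))), A h w'.1) := pow_add _ _ _
      _ ≤ ((Ideal.absNorm w.asIdeal : ℕ) : ℝ) ^ (2 * ((cL w + d₂ w) + (cL ((IsCMField.complexConj L)⁻¹ • w) + d₂ ((IsCMField.complexConj L)⁻¹ • w)))) *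
            (((Ideal.absNorm w.asIdeal : ℕ) : ℝ) ^ (8 * j w) * (GLn.localHeight (n + n) L w (h : GL (Fin (n + n)) (AdeleRing (𝓞 L) L)) : ℝ) ^ k) :=
          mul_le_mul_of_nonneg_left (hAk h w) (pow_nonneg (zero_le_one.trans hq1) _)
      _ = ((Ideal.absNorm w.asIdeal : ℕ) : ℝ) ^ (2 * ((cL w + d₂ w) + (cL ((IsCMField.complexConj L)⁻¹ • w) + d₂ ((IsCMField.complexConj L)⁻¹ • w))) + 8 * j w) *
            (GLn.localHeight (n + n) L w (h : GL (Fin (n + n)) (AdeleRing (𝓞 L) L)) : ℝ) ^ k := by rw [pow_add, mul_assoc]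
  · -- (dom) `e(w|v) · a₀ h v ≤ lev h w` (equality)
    obtain ⟨w, rfl⟩ := w
    push_cast
    exact le_rfl
  · -- (ball) §2 at `M := cL w + 2·A h w`, `d := d₂ w`: one summand of `a₀ h v` is `M + d`, and `e(w|v) ≥ 1`
    refine apply_mem_congruenceGL_of_mem_kindWLocalBall L e dV hdV dW hdW v (hπ v) u₀ hu₀ w (hϖ w.1) (cL w.1 + 2 * A h w.1) (d₂ w.1) (h2 w.1).2 ?_
    have h1 : cL w.1 + d₂ w.1 + 2 * A h w.1 ≤ ∑ w' : UnitaryGroup.PlacesOver L v, (cL w'.1 + d₂ w'.1 + 2 * A h w'.1) :=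
      Finset.single_le_sum (f := fun w' : UnitaryGroup.PlacesOver L v => cL w'.1 + d₂ w'.1 + 2 * A h w'.1) (fun _ _ => Nat.zero_le _) (Finset.mem_univ w)
    have he1 := one_le_ramificationIdx' L v w
    have h0 : (0 : ℤ) ≤ ((∑ w' : UnitaryGroup.PlacesOver L v, (cL w'.1 + d₂ w'.1 + 2 * A h w'.1) : ℕ) : ℤ) := Nat.cast_nonneg _
    calc ((cL w.1 + 2 * A h w.1 : ℕ) : ℤ) + (d₂ w.1 : ℕ)
        ≤ ((∑ w' : UnitaryGroup.PlacesOver L v, (cL w'.1 + d₂ w'.1 + 2 * A h w'.1) : ℕ) : ℤ) := by exact_mod_cast (by omega)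
      _ ≤ (v.asIdeal.ramificationIdx' w.1.asIdeal : ℤ) * ((∑ w' : UnitaryGroup.PlacesOver L v, (cL w'.1 + d₂ w'.1 + 2 * A h w'.1) : ℕ) : ℤ) :=
          le_mul_of_one_le_left h0 (by exact_mod_cast he1)
  · -- (Alev) `cL w + 2·A h w ≤ lev h w`: one summand of the sum behind `lev`, and `e(w|v) ≥ 1`
    obtain ⟨w, rfl⟩ := w
    have h1 : cL w + d₂ w + 2 * A h w ≤ ∑ w' : UnitaryGroup.PlacesOver L (w.under (𝓞 (Fp L))), (cL w'.1 + d₂ w'.1 + 2 * A h w'.1) :=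
      Finset.single_le_sum (f := fun w' : UnitaryGroup.PlacesOver L (w.under (𝓞 (Fp L))) => cL w'.1 + d₂ w'.1 + 2 * A h w'.1)
        (fun _ _ => Nat.zero_le _) (Finset.mem_univ (⟨w, rfl⟩ : UnitaryGroup.PlacesOver L (w.under (𝓞 (Fp L)))))
    have he1 := one_le_ramificationIdx' L (w.under (𝓞 (Fp L))) ⟨w, rfl⟩
    calc cL w + 2 * A h w ≤ ∑ w' : UnitaryGroup.PlacesOver L (w.under (𝓞 (Fp L))), (cL w'.1 + d₂ w'.1 + 2 * A h w'.1) := by omega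
      _ ≤ (w.under (𝓞 (Fp L))).asIdeal.ramificationIdx' w.asIdeal *
            ∑ w' : UnitaryGroup.PlacesOver L (w.under (𝓞 (Fp L))), (cL w'.1 + d₂ w'.1 + 2 * A h w'.1) := Nat.le_mul_of_pos_left _ he1

end Summit.HodgeConjecture.HodgeConjecture.Cruxes.HLiu418.K2LiuKindWFiniteLevelAdapters

end
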